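import Literature.Analysis.DeBrangesSpaces.BurnolSonineProjectionFormulaProofs
import Literature.Analysis.Fourier.L2FourierMultiplication
import HarnessLib

/-!
# Burnol, *Sur les « espaces de Sonine » associés par de Branges à la transformation de Fourier*
(C. R. Acad. Sci. Paris 335 (2002) 689–692) — Théorème 6, with proof

Burnol's note STATES Théorème 6 (TeX l.355–359) without proof ("Nous appliquons formellement la
projection orthogonale aux distributions … et cela nous mène à [Définition 1]").  This file discharges
the named fact `Burnol2002CRAS_thm6` of `BurnolSonineStructureFunction.lean` by the direct
verification from Définition 1:

* from `h_± = (1 ± F_λ)^{-1} P_λ(2cos 2πλy)` (`hPlus`, `hMinus`) and `F_λ = P_λ 𝓕 P_λ` one gets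
  `P_λ h_± = h_±`, `h_±` even, and **`h_± ± 𝓕h_± = 2cos(2πλ·)` a.e. on `[−λ,λ]`**
  (`hPlus_add_fourier_eq_ae`, `hMinus_sub_fourier_eq_ae`); hence `A_λ` and `−iB_λ` kill every Schwartz
  function supported in `(−λ,λ)`;
* testing against `𝓕φ` instead of `φ` and using `(𝓕φ)(λ) + (𝓕φ)(−λ) = ∫ φ·2cos(2πλ·)`,
  `∫ (𝓕φ)·2cos(2πλ·) = φ(λ) + φ(−λ)` (Fourier inversion on `𝓢`) and the `L²` multiplication formula
  `∫ (𝓕φ)·v = ∫ φ·(𝓕v)`, `∫ (𝓕φ)·(𝓕v) = ∫ φ·v` (`v` even), one gets `𝓕A_λ = A_λ` and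
  `𝓕(−iB_λ) = −(−iB_λ)` — the two deltas and `2cos(2πλt)` are exchanged by `𝓕`, and so are `h_±`
  and `𝓕h_±`.

RH-FREE throughout (`L²`/`𝓢'` bookkeeping; `ζ` does not occur).

## References
* [Burnol2002CRAS] J.-F. Burnol, C. R. Acad. Sci. Paris, Ser. I 335 (2002) 689–692, §4,
  Définition 1 (TeX l.346–352), Théorème 6 (TeX l.355–359).
* [Grafakos2014] L. Grafakos, *Classical Fourier Analysis*, 3rd ed., GTM 249 (2014), Def. 2.2.8
  (PDF p. 125), Thm. 2.2.14 (1)–(2) (PDF p. 128: multiplication formula, Fourier inversion).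
-/


open MeasureTheory Set Filter Complex FourierTransform
open scoped Real Topology ENNReal FourierTransform ComplexConjugate SchwartzMap

open Literature.NumberTheory.ConnesConsani2021 (cutoffProj cutoffProjHat compNeg_cutoffProj
  cutoffProj_coeFn cutoffProj_idem)
open Literature.Analysis.Fourier (coeFn_compNeg compNeg_compNeg fourier_compNeg
  fourier_fourier_eq_compNeg integral_mul_fourier_eq integral_fourier_mul_eq)

namespace Literature.Analysis.DeBrangesSpaces

namespace Burnol2002

/-! ## Ring lemmas for `Ring.inverse` -/

section Abstract

variable {R : Type*} [Ring R]

/-- `a⁻¹ a = 1 = a a⁻¹` for `Ring.inverse` of a unit. [folklore] -/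
private theorem inverse_mul_cancel_and {a : R} (h : IsUnit a) :
    Ring.inverse a * a = 1 ∧ a * Ring.inverse a = 1 :=
  ⟨Ring.inverse_mul_cancel _ h, Ring.mul_inverse_cancel _ h⟩

/-- `Ring.inverse a` commutes with everything commuting with the unit `a`. [folklore] -/
private theorem commute_inverse_of_commute {s a : R} (h : IsUnit a) (hs : Commute s a) :
    Commute s (Ring.inverse a) := by
  obtain ⟨u, hu⟩ := h
  rw [← hu, Ring.inverse_unit]
  have : Commute s (u : R) := by rw [hu]; exact hs
  exact this.units_inv_right

end Abstract

/-! ## The vectors `h_± = (1 ± F_λ)^{-1} P_λ(2cos 2πλy)` -/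

/-- `P_λ (P_λ z) = P_λ z`. [cite: Burnol2002CRAS, §3 (TeX l.259–262)] -/
private theorem cutoffProj_cutoffProj' (lam : ℝ) (z : Lp ℂ 2 (volume : Measure ℝ)) :
    cutoffProj lam (cutoffProj lam z) = cutoffProj lam z := by
  have h := congrArg (fun T : Lp ℂ 2 (volume : Measure ℝ) →L[ℂ] Lp ℂ 2 (volume : Measure ℝ) ↦ T z)
    (cutoffProj_idem lam).eq
  simpa only [mul_apply_eq_comp] using h

/-- `P_λ` commutes with `F_λ = P_λ 𝓕 P_λ` (both products equal `F_λ`).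
[cite: Burnol2002CRAS, Lemme 2, proof (TeX l.279–281)] -/
private theorem commute_cutoffProj_slepianF (lam : ℝ) :
    Commute (cutoffProj lam) (slepianF lam) := by
  refine (Commute.symm ?_)
  change slepianF lam * cutoffProj lam = cutoffProj lam * slepianF lam
  ext1 z
  rw [mul_apply_eq_comp, mul_apply_eq_comp, slepianF_apply, slepianF_apply, cutoffProj_cutoffProj',
    cutoffProj_cutoffProj']

/-- **`(1 + F_λ) h_+ = P_λ(2cos 2πλy)`**: `h_+ + F_λ h_+ = cosCut`.
[cite: Burnol2002CRAS, Définition 2 (TeX l.361–364)] -/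
theorem hPlus_add_slepianF (lam : ℝ) : hPlus lam + slepianF lam (hPlus lam) = cosCut lam := by
  have h2 := (inverse_mul_cancel_and (isUnit_one_add_slepianF lam)).2
  have e := congrArg (fun T : Lp ℂ 2 (volume : Measure ℝ) →L[ℂ] Lp ℂ 2 (volume : Measure ℝ) ↦
    T (cosCut lam)) h2
  simp only [mul_apply_eq_comp, add_apply, one_apply_eq_self] at e
  exact e

/-- **`(1 − F_λ) h_− = P_λ(2cos 2πλy)`**: `h_− − F_λ h_− = cosCut`.
[cite: Burnol2002CRAS, Définition 2 (TeX l.365–367)] -/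
theorem hMinus_sub_slepianF (lam : ℝ) : hMinus lam - slepianF lam (hMinus lam) = cosCut lam := by
  have h2 := (inverse_mul_cancel_and (isUnit_one_sub_slepianF lam)).2
  have e := congrArg (fun T : Lp ℂ 2 (volume : Measure ℝ) →L[ℂ] Lp ℂ 2 (volume : Measure ℝ) ↦
    T (cosCut lam)) h2
  simp only [mul_apply_eq_comp, sub_apply, one_apply_eq_self] at e
  exact e

/-- `cosCut = 𝟙_{[−λ,λ]}·2cos(2πλ·)` almost everywhere. [cite: Burnol2002CRAS, Définition 1 (TeX l.346–352)] -/
theorem cosCut_coeFn (lam : ℝ) :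
    (cosCut lam : ℝ → ℂ) =ᵐ[volume] (Icc (-lam) lam).indicator (twoCos lam) :=
  (memLp_indicator_twoCos lam).coeFn_toLp

/-- `P_λ cosCut = cosCut`. [cite: Burnol2002CRAS, Définition 1 (TeX l.346–352)] -/
theorem cutoffProj_cosCut (lam : ℝ) : cutoffProj lam (cosCut lam) = cosCut lam := by
  refine Lp.ext ?_
  filter_upwards [cutoffProj_coeFn lam (cosCut lam), cosCut_coeFn lam] with x hx hc
  rw [hx]
  by_cases h : x ∈ Icc (-lam) lam
  · rw [Set.indicator_of_mem h]
  · rw [Set.indicator_of_notMem h, hc, Set.indicator_of_notMem h]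

/-- `P_λ h_+ = h_+` (`P_λ` commutes with `(1 + F_λ)^{-1}` and fixes `cosCut`).
[cite: Burnol2002CRAS, Définition 2 (TeX l.361–364)] -/
theorem cutoffProj_hPlus (lam : ℝ) : cutoffProj lam (hPlus lam) = hPlus lam := by
  have hc : Commute (cutoffProj lam) (1 + slepianF lam) :=
    (Commute.one_right _).add_right (commute_cutoffProj_slepianF lam)
  have h := (commute_inverse_of_commute (isUnit_one_add_slepianF lam) hc).eq
  have e := congrArg (fun T : Lp ℂ 2 (volume : Measure ℝ) →L[ℂ] Lp ℂ 2 (volume : Measure ℝ) ↦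
    T (cosCut lam)) h
  simp only [mul_apply_eq_comp] at e
  rw [cutoffProj_cosCut] at e
  exact e

/-- `P_λ h_− = h_−`. [cite: Burnol2002CRAS, Définition 2 (TeX l.365–367)] -/
theorem cutoffProj_hMinus (lam : ℝ) : cutoffProj lam (hMinus lam) = hMinus lam := by
  have hc : Commute (cutoffProj lam) (1 - slepianF lam) :=
    (Commute.one_right _).sub_right (commute_cutoffProj_slepianF lam)
  have h := (commute_inverse_of_commute (isUnit_one_sub_slepianF lam) hc).eq
  have e := congrArg (fun T : Lp ℂ 2 (volume : Measure ℝ) →L[ℂ] Lp ℂ 2 (volume : Measure ℝ) ↦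
    T (cosCut lam)) h
  simp only [mul_apply_eq_comp] at e
  rw [cutoffProj_cosCut] at e
  exact e

/-- **`h_+ + P_λ 𝓕 h_+ = P_λ(2cos 2πλy)`** in `L²(ℝ)`. [cite: Burnol2002CRAS, Définition 2 (TeX l.361–364)] -/
theorem hPlus_add_cutoffProj_fourier (lam : ℝ) :
    hPlus lam + cutoffProj lam (𝓕 (hPlus lam) : Lp ℂ 2 (volume : Measure ℝ)) = cosCut lam := by
  have h := hPlus_add_slepianF lam
  rwa [slepianF_apply, cutoffProj_hPlus] at h

/-- **`h_− − P_λ 𝓕 h_− = P_λ(2cos 2πλy)`** in `L²(ℝ)`. [cite: Burnol2002CRAS, Définition 2 (TeX l.365–367)] -/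
theorem hMinus_sub_cutoffProj_fourier (lam : ℝ) :
    hMinus lam - cutoffProj lam (𝓕 (hMinus lam) : Lp ℂ 2 (volume : Measure ℝ)) = cosCut lam := by
  have h := hMinus_sub_slepianF lam
  rwa [slepianF_apply, cutoffProj_hMinus] at h

/-- **`h_+ + 𝓕h_+ = 2cos(2πλ·)` a.e. on `[−λ,λ]`.** [cite: Burnol2002CRAS, Définition 2 (TeX l.361–364)] -/
theorem hPlus_add_fourier_eq_ae (lam : ℝ) :
    ∀ᵐ x : ℝ, x ∈ Icc (-lam) lam →
      hPlus lam x + (𝓕 (hPlus lam) : Lp ℂ 2 (volume : Measure ℝ)) x = twoCos lam x := by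
  have h := hPlus_add_cutoffProj_fourier lam
  have h1 : (cosCut lam : ℝ → ℂ) =ᵐ[volume]
      (hPlus lam + cutoffProj lam (𝓕 (hPlus lam) : Lp ℂ 2 (volume : Measure ℝ)) :
        Lp ℂ 2 (volume : Measure ℝ)) := by rw [h]
  filter_upwards [h1, cosCut_coeFn lam,
    Lp.coeFn_add (hPlus lam) (cutoffProj lam (𝓕 (hPlus lam) : Lp ℂ 2 (volume : Measure ℝ))),
    cutoffProj_coeFn lam (𝓕 (hPlus lam) : Lp ℂ 2 (volume : Measure ℝ))] with x e1 e2 e3 e4 hx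
  have e : (Icc (-lam) lam).indicator (twoCos lam) x =
      hPlus lam x + (Icc (-lam) lam).indicator
        ((𝓕 (hPlus lam) : Lp ℂ 2 (volume : Measure ℝ)) : ℝ → ℂ) x := by
    rw [← e2, e1, e3, Pi.add_apply, e4]
  rw [Set.indicator_of_mem hx, Set.indicator_of_mem hx] at e
  exact e.symm

/-- **`h_− − 𝓕h_− = 2cos(2πλ·)` a.e. on `[−λ,λ]`.** [cite: Burnol2002CRAS, Définition 2 (TeX l.365–367)] -/
theorem hMinus_sub_fourier_eq_ae (lam : ℝ) :
    ∀ᵐ x : ℝ, x ∈ Icc (-lam) lam →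
      hMinus lam x - (𝓕 (hMinus lam) : Lp ℂ 2 (volume : Measure ℝ)) x = twoCos lam x := by
  have h := hMinus_sub_cutoffProj_fourier lam
  have h1 : (cosCut lam : ℝ → ℂ) =ᵐ[volume]
      (hMinus lam - cutoffProj lam (𝓕 (hMinus lam) : Lp ℂ 2 (volume : Measure ℝ)) :
        Lp ℂ 2 (volume : Measure ℝ)) := by rw [h]
  filter_upwards [h1, cosCut_coeFn lam,
    Lp.coeFn_sub (hMinus lam) (cutoffProj lam (𝓕 (hMinus lam) : Lp ℂ 2 (volume : Measure ℝ))),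
    cutoffProj_coeFn lam (𝓕 (hMinus lam) : Lp ℂ 2 (volume : Measure ℝ))] with x e1 e2 e3 e4 hx
  have e : (Icc (-lam) lam).indicator (twoCos lam) x =
      hMinus lam x - (Icc (-lam) lam).indicator
        ((𝓕 (hMinus lam) : Lp ℂ 2 (volume : Measure ℝ)) : ℝ → ℂ) x := by
    rw [← e2, e1, e3, Pi.sub_apply, e4]
  rw [Set.indicator_of_mem hx, Set.indicator_of_mem hx] at e
  exact e.symm

/-- `h_+ = 0` a.e. off `[−λ,λ]`. [cite: Burnol2002CRAS, Définition 2 (TeX l.361–364)] -/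
theorem hPlus_eq_zero_ae (lam : ℝ) :
    ∀ᵐ x : ℝ, x ∉ Icc (-lam) lam → hPlus lam x = 0 := by
  have h1 : (hPlus lam : ℝ → ℂ) =ᵐ[volume] (cutoffProj lam (hPlus lam) : Lp ℂ 2 (volume : Measure ℝ)) := by
    rw [cutoffProj_hPlus]
  filter_upwards [h1, cutoffProj_coeFn lam (hPlus lam)] with x e1 e2 hx
  rw [e1, e2, Set.indicator_of_notMem hx]

/-- `h_− = 0` a.e. off `[−λ,λ]`. [cite: Burnol2002CRAS, Définition 2 (TeX l.365–367)] -/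
theorem hMinus_eq_zero_ae (lam : ℝ) :
    ∀ᵐ x : ℝ, x ∉ Icc (-lam) lam → hMinus lam x = 0 := by
  have h1 : (hMinus lam : ℝ → ℂ) =ᵐ[volume] (cutoffProj lam (hMinus lam) : Lp ℂ 2 (volume : Measure ℝ)) := by
    rw [cutoffProj_hMinus]
  filter_upwards [h1, cutoffProj_coeFn lam (hMinus lam)] with x e1 e2 hx
  rw [e1, e2, Set.indicator_of_notMem hx]

/-! ## Evenness of `h_±` -/

/-- `R (F_λ z) = F_λ (R z)` (`R` = the reflection `u ↦ u(−·)`). [folklore] -/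
private theorem compNeg_slepianF' (lam : ℝ) (z : Lp ℂ 2 (volume : Measure ℝ)) :
    Lp.compMeasurePreserving (fun x : ℝ ↦ -x) (Measure.measurePreserving_neg (volume : Measure ℝ))
        (slepianF lam z) =
      slepianF lam (Lp.compMeasurePreserving (fun x : ℝ ↦ -x)
        (Measure.measurePreserving_neg (volume : Measure ℝ)) z) := by
  rw [slepianF_apply, slepianF_apply, compNeg_cutoffProj, ← fourier_compNeg, compNeg_cutoffProj]

/-- `𝟙_{[−λ,λ]}·2cos(2πλ·)` is an even function. [cite: Burnol2002CRAS, Définition 1 (TeX l.346–352)] -/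
private theorem indicator_twoCos_neg (lam x : ℝ) :
    (Icc (-lam) lam).indicator (twoCos lam) (-x) = (Icc (-lam) lam).indicator (twoCos lam) x := by
  have hc : twoCos lam (-x) = twoCos lam x := by
    simp only [twoCos, mul_neg, Real.cos_neg]
  by_cases hx : x ∈ Icc (-lam) lam
  · have hx' : -x ∈ Icc (-lam) lam := by
      rw [mem_Icc] at hx ⊢; constructor <;> linarith [hx.1, hx.2]
    rw [Set.indicator_of_mem hx, Set.indicator_of_mem hx', hc]
  · have hx' : -x ∉ Icc (-lam) lam := by
      intro h; apply hx; rw [mem_Icc] at h ⊢; constructor <;> linarith [h.1, h.2]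
    rw [Set.indicator_of_notMem hx, Set.indicator_of_notMem hx']

/-- `cosCut` is fixed by the reflection. [cite: Burnol2002CRAS, Définition 1 (TeX l.346–352)] -/
theorem compNeg_cosCut (lam : ℝ) :
    Lp.compMeasurePreserving (fun x : ℝ ↦ -x) (Measure.measurePreserving_neg (volume : Measure ℝ))
      (cosCut lam) = cosCut lam := by
  have hq : Measure.QuasiMeasurePreserving (fun x : ℝ ↦ -x) volume volume :=
    (Measure.measurePreserving_neg (volume : Measure ℝ)).quasiMeasurePreserving
  refine Lp.ext ?_
  filter_upwards [coeFn_compNeg (F := ℂ) (cosCut lam), cosCut_coeFn lam,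
    hq.ae_eq_comp (cosCut_coeFn lam)] with x h1 h2 h3
  rw [h1]
  simp only [Function.comp_apply] at h3
  rw [h3, indicator_twoCos_neg, h2]

/-- **`h_+` is even**: `R h_+ = h_+` (`R` commutes with `F_λ`, fixes `cosCut`, and `1 + F_λ` is
injective). [cite: Burnol2002CRAS, Définition 2 (TeX l.361–364)] -/
theorem compNeg_hPlus (lam : ℝ) :
    Lp.compMeasurePreserving (fun x : ℝ ↦ -x) (Measure.measurePreserving_neg (volume : Measure ℝ))
      (hPlus lam) = hPlus lam := by
  set R' := Lp.compMeasurePreserving (fun x : ℝ ↦ -x) (Measure.measurePreserving_neg (volume : Measure ℝ))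
    (E := ℂ) (p := (2 : ENNReal)) with hR'
  have h1 : hPlus lam + slepianF lam (hPlus lam) = cosCut lam := hPlus_add_slepianF lam
  -- apply `R`
  have h2 : R' (hPlus lam) + slepianF lam (R' (hPlus lam)) = cosCut lam := by
    have := congrArg R' h1
    rwa [map_add, compNeg_slepianF', compNeg_cosCut] at this
  -- apply `(1 + F)^{-1}`
  have h3 := (inverse_mul_cancel_and (isUnit_one_add_slepianF lam)).1
  have e := congrArg (fun T : Lp ℂ 2 (volume : Measure ℝ) →L[ℂ] Lp ℂ 2 (volume : Measure ℝ) ↦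
    T (R' (hPlus lam))) h3
  simp only [mul_apply_eq_comp, add_apply, one_apply_eq_self] at e
  rw [h2] at e
  exact e.symm

/-- **`h_−` is even**: `R h_− = h_−`. [cite: Burnol2002CRAS, Définition 2 (TeX l.365–367)] -/
theorem compNeg_hMinus (lam : ℝ) :
    Lp.compMeasurePreserving (fun x : ℝ ↦ -x) (Measure.measurePreserving_neg (volume : Measure ℝ))
      (hMinus lam) = hMinus lam := by
  set R' := Lp.compMeasurePreserving (fun x : ℝ ↦ -x) (Measure.measurePreserving_neg (volume : Measure ℝ))
    (E := ℂ) (p := (2 : ENNReal)) with hR'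
  have h1 : hMinus lam - slepianF lam (hMinus lam) = cosCut lam := hMinus_sub_slepianF lam
  have h2 : R' (hMinus lam) - slepianF lam (R' (hMinus lam)) = cosCut lam := by
    have := congrArg R' h1
    rwa [map_sub, compNeg_slepianF', compNeg_cosCut] at this
  have h3 := (inverse_mul_cancel_and (isUnit_one_sub_slepianF lam)).1
  have e := congrArg (fun T : Lp ℂ 2 (volume : Measure ℝ) →L[ℂ] Lp ℂ 2 (volume : Measure ℝ) ↦
    T (R' (hMinus lam))) h3
  simp only [mul_apply_eq_comp, sub_apply, one_apply_eq_self] at e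
  rw [h2] at e
  exact e.symm

/-- `𝓕𝓕 h_+ = h_+` (`𝓕² = R` and `h_+` is even). [cite: Burnol2002CRAS, Définition 2 (TeX l.361–364)] -/
theorem fourier_fourier_hPlus (lam : ℝ) :
    (𝓕 (𝓕 (hPlus lam) : Lp ℂ 2 (volume : Measure ℝ)) : Lp ℂ 2 (volume : Measure ℝ)) = hPlus lam := by
  rw [fourier_fourier_eq_compNeg, compNeg_hPlus]

/-- `𝓕𝓕 h_− = h_−`. [cite: Burnol2002CRAS, Définition 2 (TeX l.365–367)] -/
theorem fourier_fourier_hMinus (lam : ℝ) :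
    (𝓕 (𝓕 (hMinus lam) : Lp ℂ 2 (volume : Measure ℝ)) : Lp ℂ 2 (volume : Measure ℝ)) = hMinus lam := by
  rw [fourier_fourier_eq_compNeg, compNeg_hMinus]

/-! ## Scalar identities for Schwartz test functions -/

/-- `(𝓕φ)(λ) + (𝓕φ)(−λ) = ∫ φ(x)·(𝐞(λx) + 𝐞(−λx)) dx` (the definition of `φ̂` at `±λ`).
[cite: Grafakos2014, Def. 2.2.8, PDF p. 125] -/
theorem fourier_apply_add_fourier_apply_neg (φ : 𝓢(ℝ, ℂ)) (lam : ℝ) :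
    (𝓕 φ : 𝓢(ℝ, ℂ)) lam + (𝓕 φ : 𝓢(ℝ, ℂ)) (-lam) =
      ∫ x : ℝ, φ x * (((𝐞 (lam * x) : Circle) : ℂ) + ((𝐞 (-(lam * x)) : Circle) : ℂ)) := by
  have hint : ∀ w : ℝ, Integrable (fun v : ℝ ↦ 𝐞 (-(v * w)) • φ v) := by
    intro w
    refine (φ.integrable.norm).mono' ?_ (Eventually.of_forall fun v ↦ ?_)
    · exact ((Real.continuous_fourierChar.comp (by fun_prop)).smul φ.continuous).aestronglyMeasurable
    · rw [Circle.smul_def, norm_smul, Circle.norm_coe, one_mul]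
  rw [SchwartzMap.fourier_coe, Real.fourier_real_eq, Real.fourier_real_eq, ← integral_add (hint lam)
    (hint (-lam))]
  refine integral_congr_ae (Eventually.of_forall fun v ↦ ?_)
  simp only [Circle.smul_def, smul_eq_mul]
  rw [mul_neg, neg_neg, mul_comm v lam]
  ring

/-- `∫ (𝓕φ)(x)·(𝐞(λx) + 𝐞(−λx)) dx = φ(λ) + φ(−λ)` (Fourier inversion on `𝓢`: `(φ̂)^∨ = φ`).
[cite: Grafakos2014, Thm. 2.2.14 (2), PDF p. 128] -/
theorem integral_fourier_mul_twoChar (φ : 𝓢(ℝ, ℂ)) (lam : ℝ) :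
    ∫ x : ℝ, (𝓕 φ : 𝓢(ℝ, ℂ)) x * (((𝐞 (lam * x) : Circle) : ℂ) + ((𝐞 (-(lam * x)) : Circle) : ℂ)) =
      φ lam + φ (-lam) := by
  rw [← fourier_apply_add_fourier_apply_neg]
  have h : ∀ w : ℝ, (𝓕 (𝓕 φ : 𝓢(ℝ, ℂ)) : 𝓢(ℝ, ℂ)) w = φ (-w) := by
    intro w
    have e1 : ((𝓕 (𝓕 φ : 𝓢(ℝ, ℂ)) : 𝓢(ℝ, ℂ)) : ℝ → ℂ) w = 𝓕 ((𝓕 φ : 𝓢(ℝ, ℂ)) : ℝ → ℂ) w := by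
      rw [SchwartzMap.fourier_coe]
    rw [e1, ← neg_neg w, ← Real.fourierInv_eq_fourier_neg, neg_neg]
    have e2 : ((𝓕⁻ (𝓕 φ : 𝓢(ℝ, ℂ)) : 𝓢(ℝ, ℂ)) : ℝ → ℂ) = 𝓕⁻ ((𝓕 φ : 𝓢(ℝ, ℂ)) : ℝ → ℂ) :=
      SchwartzMap.fourierInv_coe _
    rw [← congrFun e2 (-w), FourierTransform.fourierInv_fourier_eq]
  rw [h, h, neg_neg, add_comm]

/-- `∫ (𝓕φ)·v = ∫ φ·(𝓕v)` for `φ ∈ 𝓢` and `v ∈ L²` (multiplication formula).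
[cite: Grafakos2014, Thm. 2.2.14 (1), PDF p. 128] -/
theorem integral_fourier_schwartz_mul (φ : 𝓢(ℝ, ℂ)) (v : Lp ℂ 2 (volume : Measure ℝ)) :
    ∫ x : ℝ, (𝓕 φ : 𝓢(ℝ, ℂ)) x * v x =
      ∫ x : ℝ, φ x * (𝓕 v : Lp ℂ 2 (volume : Measure ℝ)) x := by
  have h1 : ∫ x : ℝ, (𝓕 φ : 𝓢(ℝ, ℂ)) x * v x =
      ∫ x : ℝ, ((𝓕 (φ.toLp 2 (volume : Measure ℝ)) : Lp ℂ 2 (volume : Measure ℝ)) : ℝ → ℂ) x * v x := by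
    refine integral_congr_ae ?_
    rw [SchwartzMap.toLp_fourier_eq]
    filter_upwards [((𝓕 φ : 𝓢(ℝ, ℂ))).coeFn_toLp 2 (volume : Measure ℝ)] with x hx
    rw [hx]
  have h2 : ∫ x : ℝ, φ x * (𝓕 v : Lp ℂ 2 (volume : Measure ℝ)) x =
      ∫ x : ℝ, ((φ.toLp 2 (volume : Measure ℝ)) : ℝ → ℂ) x * (𝓕 v : Lp ℂ 2 (volume : Measure ℝ)) x := by
    refine integral_congr_ae ?_
    filter_upwards [φ.coeFn_toLp 2 (volume : Measure ℝ)] with x hx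
    rw [hx]
  rw [h1, h2, integral_fourier_mul_eq]

/-- `∫ (𝓕φ)·(𝓕v) = ∫ φ·v` for `φ ∈ 𝓢` and an EVEN `v ∈ L²` (`𝓕𝓕v = Rv = v`).
[cite: Grafakos2014, Thm. 2.2.14 (1)–(2), PDF p. 128] -/
theorem integral_fourier_schwartz_mul_fourier (φ : 𝓢(ℝ, ℂ)) {v : Lp ℂ 2 (volume : Measure ℝ)}
    (hv : Lp.compMeasurePreserving (fun x : ℝ ↦ -x) (Measure.measurePreserving_neg (volume : Measure ℝ))
      v = v) :
    ∫ x : ℝ, (𝓕 φ : 𝓢(ℝ, ℂ)) x * (𝓕 v : Lp ℂ 2 (volume : Measure ℝ)) x = ∫ x : ℝ, φ x * v x := by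
  rw [integral_fourier_schwartz_mul, fourier_fourier_eq_compNeg, hv]

/-! ## Théorème 6 -/

/-- The value of `A_λ` on a test function (unfolding Définition 1).
[cite: Burnol2002CRAS, Définition 1 (TeX l.346–350)] -/
theorem distA_apply (lam : ℝ) (φ : 𝓢(ℝ, ℂ)) :
    distA lam φ = φ (-lam) + φ lam +
      (∫ x : ℝ, φ x * (((𝐞 (lam * x) : Circle) : ℂ) + ((𝐞 (-(lam * x)) : Circle) : ℂ))) -
      ∫ x : ℝ, φ x * ((hPlus lam + fourierL2 (hPlus lam) : Lp ℂ 2 (volume : Measure ℝ)) : ℝ → ℂ) x := by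
  simp only [distA, sub_apply, add_apply,
    TemperedDistribution.delta_apply, Function.HasTemperateGrowth.toTemperedDistribution_apply,
    MeasureTheory.Lp.toTemperedDistribution_apply, smul_eq_mul]

/-- The value of `−iB_λ` on a test function (unfolding Définition 1).
[cite: Burnol2002CRAS, Définition 1 (TeX l.350–352)] -/
theorem distNegIB_apply (lam : ℝ) (φ : 𝓢(ℝ, ℂ)) :
    distNegIB lam φ = φ (-lam) + φ lam -
      (∫ x : ℝ, φ x * (((𝐞 (lam * x) : Circle) : ℂ) + ((𝐞 (-(lam * x)) : Circle) : ℂ))) +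
      ∫ x : ℝ, φ x * ((hMinus lam - fourierL2 (hMinus lam) : Lp ℂ 2 (volume : Measure ℝ)) : ℝ → ℂ) x := by
  simp only [distNegIB, sub_apply, add_apply,
    TemperedDistribution.delta_apply, Function.HasTemperateGrowth.toTemperedDistribution_apply,
    MeasureTheory.Lp.toTemperedDistribution_apply, smul_eq_mul]

/-- A Schwartz function supported in `(−λ, λ)` vanishes off `[−λ,λ]` and at `±λ`. [folklore] -/
private theorem eq_zero_of_tsupport_subset {lam : ℝ} {φ : 𝓢(ℝ, ℂ)}
    (hφ : tsupport φ ⊆ Ioo (-lam) lam) {x : ℝ} (hx : x ∉ Ioo (-lam) lam) : φ x = 0 :=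
  image_eq_zero_of_notMem_tsupport fun h ↦ hx (hφ h)

/-- For `φ` supported in `(−λ,λ)`: `∫ φ·(h_+ + 𝓕h_+) = ∫ φ·(𝐞(λ·) + 𝐞(−λ·))`.
[cite: Burnol2002CRAS, Théorème 6 (TeX l.355–359)] -/
theorem integral_mul_hPlus_add_fourier_of_tsupport {lam : ℝ} {φ : 𝓢(ℝ, ℂ)}
    (hφ : tsupport φ ⊆ Ioo (-lam) lam) :
    ∫ x : ℝ, φ x * ((hPlus lam + fourierL2 (hPlus lam) : Lp ℂ 2 (volume : Measure ℝ)) : ℝ → ℂ) x =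
      ∫ x : ℝ, φ x * (((𝐞 (lam * x) : Circle) : ℂ) + ((𝐞 (-(lam * x)) : Circle) : ℂ)) := by
  refine integral_congr_ae ?_
  filter_upwards [Lp.coeFn_add (hPlus lam) (fourierL2 (hPlus lam)), hPlus_add_fourier_eq_ae lam]
    with x e1 e2
  by_cases hx : x ∈ Icc (-lam) lam
  · rw [e1, Pi.add_apply, fourierL2_apply, e2 hx, twoChar_eq_twoCos]
  · have hx' : x ∉ Ioo (-lam) lam := fun h ↦ hx (Ioo_subset_Icc_self h)
    rw [eq_zero_of_tsupport_subset hφ hx', zero_mul, zero_mul]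

/-- For `φ` supported in `(−λ,λ)`: `∫ φ·(h_− − 𝓕h_−) = ∫ φ·(𝐞(λ·) + 𝐞(−λ·))`.
[cite: Burnol2002CRAS, Théorème 6 (TeX l.355–359)] -/
theorem integral_mul_hMinus_sub_fourier_of_tsupport {lam : ℝ} {φ : 𝓢(ℝ, ℂ)}
    (hφ : tsupport φ ⊆ Ioo (-lam) lam) :
    ∫ x : ℝ, φ x * ((hMinus lam - fourierL2 (hMinus lam) : Lp ℂ 2 (volume : Measure ℝ)) : ℝ → ℂ) x =
      ∫ x : ℝ, φ x * (((𝐞 (lam * x) : Circle) : ℂ) + ((𝐞 (-(lam * x)) : Circle) : ℂ)) := by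
  refine integral_congr_ae ?_
  filter_upwards [Lp.coeFn_sub (hMinus lam) (fourierL2 (hMinus lam)), hMinus_sub_fourier_eq_ae lam]
    with x e1 e2
  by_cases hx : x ∈ Icc (-lam) lam
  · rw [e1, Pi.sub_apply, fourierL2_apply, e2 hx, twoChar_eq_twoCos]
  · have hx' : x ∉ Ioo (-lam) lam := fun h ↦ hx (Ioo_subset_Icc_self h)
    rw [eq_zero_of_tsupport_subset hφ hx', zero_mul, zero_mul]

/-- **Théorème 6, Sonine property of `A_λ` (first half)**: `A_λ(φ) = 0` for `φ ∈ 𝓢` supported in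
`(−λ,λ)`. [cite: Burnol2002CRAS, Théorème 6 (TeX l.355–359)] -/
theorem distA_apply_eq_zero {lam : ℝ} {φ : 𝓢(ℝ, ℂ)} (hφ : tsupport φ ⊆ Ioo (-lam) lam) :
    distA lam φ = 0 := by
  have h1 : φ (-lam) = 0 :=
    eq_zero_of_tsupport_subset hφ fun h ↦ (lt_irrefl _ h.1)
  have h2 : φ lam = 0 :=
    eq_zero_of_tsupport_subset hφ fun h ↦ (lt_irrefl _ h.2)
  rw [distA_apply, h1, h2, integral_mul_hPlus_add_fourier_of_tsupport hφ]
  ring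

/-- **Théorème 6, Sonine property of `−iB_λ` (first half)**: `−iB_λ(φ) = 0` for `φ ∈ 𝓢` supported
in `(−λ,λ)`. [cite: Burnol2002CRAS, Théorème 6 (TeX l.355–359)] -/
theorem distNegIB_apply_eq_zero {lam : ℝ} {φ : 𝓢(ℝ, ℂ)} (hφ : tsupport φ ⊆ Ioo (-lam) lam) :
    distNegIB lam φ = 0 := by
  have h1 : φ (-lam) = 0 :=
    eq_zero_of_tsupport_subset hφ fun h ↦ (lt_irrefl _ h.1)
  have h2 : φ lam = 0 :=
    eq_zero_of_tsupport_subset hφ fun h ↦ (lt_irrefl _ h.2)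
  rw [distNegIB_apply, h1, h2, integral_mul_hMinus_sub_fourier_of_tsupport hφ]
  ring

/-- `𝓕 (h_+ + 𝓕h_+) = h_+ + 𝓕h_+` in `L²`. [cite: Burnol2002CRAS, Théorème 6 (TeX l.355–359)] -/
theorem fourier_hPlus_add_fourier (lam : ℝ) :
    (𝓕 (hPlus lam + fourierL2 (hPlus lam)) : Lp ℂ 2 (volume : Measure ℝ)) =
      hPlus lam + fourierL2 (hPlus lam) := by
  rw [fourierL2_apply, FourierAdd.fourier_add, fourier_fourier_hPlus, add_comm]

/-- `𝓕 (h_− − 𝓕h_−) = −(h_− − 𝓕h_−)` in `L²`. [cite: Burnol2002CRAS, Théorème 6 (TeX l.355–359)] -/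
theorem fourier_hMinus_sub_fourier (lam : ℝ) :
    (𝓕 (hMinus lam - fourierL2 (hMinus lam)) : Lp ℂ 2 (volume : Measure ℝ)) =
      -(hMinus lam - fourierL2 (hMinus lam)) := by
  rw [fourierL2_apply, sub_eq_add_neg, FourierAdd.fourier_add, FourierTransform.fourier_neg,
    fourier_fourier_hMinus]
  abel

/-- **Théorème 6: `A_λ` is Fourier invariant**, `𝓕A_λ = A_λ` (the deltas `δ_{±λ}` and `2cos(2πλt)`
are exchanged by `𝓕`, and so are `h_+` and `𝓕h_+`). [cite: Burnol2002CRAS, Théorème 6 (TeX l.355–359)] -/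
theorem fourier_distA (lam : ℝ) : 𝓕 (distA lam) = distA lam := by
  ext φ
  rw [TemperedDistribution.fourier_apply, distA_apply, distA_apply,
    add_comm ((𝓕 φ : 𝓢(ℝ, ℂ)) (-lam)), fourier_apply_add_fourier_apply_neg,
    integral_fourier_mul_twoChar, integral_fourier_schwartz_mul, fourier_hPlus_add_fourier]
  ring

/-- **Théorème 6: `−iB_λ` is Fourier anti-invariant**, `𝓕(−iB_λ) = −(−iB_λ)`.
[cite: Burnol2002CRAS, Théorème 6 (TeX l.355–359)] -/
theorem fourier_distNegIB (lam : ℝ) : 𝓕 (distNegIB lam) = -distNegIB lam := by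
  ext φ
  rw [TemperedDistribution.fourier_apply, neg_apply, distNegIB_apply, distNegIB_apply,
    add_comm ((𝓕 φ : 𝓢(ℝ, ℂ)) (-lam)), fourier_apply_add_fourier_apply_neg,
    integral_fourier_mul_twoChar, integral_fourier_schwartz_mul, fourier_hMinus_sub_fourier]
  have h : ∫ x : ℝ, φ x * ((-(hMinus lam - fourierL2 (hMinus lam)) : Lp ℂ 2 (volume : Measure ℝ)) :
      ℝ → ℂ) x = -∫ x : ℝ, φ x *
        ((hMinus lam - fourierL2 (hMinus lam) : Lp ℂ 2 (volume : Measure ℝ)) : ℝ → ℂ) x := by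
    rw [← integral_neg]
    refine integral_congr_ae ?_
    filter_upwards [Lp.coeFn_neg (hMinus lam - fourierL2 (hMinus lam))] with x hx
    rw [hx, Pi.neg_apply, mul_neg]
  rw [h]
  ring

/-- **Théorème 6 (Burnol 2002) holds.** The even tempered distributions `A_λ` and `−iB_λ` vanish,
together with their Fourier transforms, on `(−λ,λ)` (tested on Schwartz functions supported there),
and `𝓕A_λ = A_λ`, `𝓕(−iB_λ) = −(−iB_λ)`. Discharges the named fact `Burnol2002CRAS_thm6`.
[cite: Burnol2002CRAS, Théorème 6 (TeX l.355–359)] -/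
theorem Burnol2002CRAS_thm6_holds : Burnol2002CRAS_thm6 := by
  intro lam _
  refine ⟨fun φ hφ ↦ ⟨distA_apply_eq_zero hφ, ?_, distNegIB_apply_eq_zero hφ, ?_⟩,
    fourier_distA lam, fourier_distNegIB lam⟩
  · rw [fourier_distA]; exact distA_apply_eq_zero hφ
  · rw [fourier_distNegIB, neg_apply, distNegIB_apply_eq_zero hφ, neg_zero]

end Burnol2002

end Literature.Analysis.DeBrangesSpaces
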